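import Literature.Probability.LatticeModels.ClusteringToTreeBound
import Literature.Probability.LatticeModels.WeightedCurrentsDictionary
import HarnessLib

/-!
# The improved tree diagram bound for correlation ratios, modulo the clustering bound (Aizenman–Duminil-Copin 2021, §4.1/§6.1, proof of Thm 1.3)

Topic `Literature/Probability/LatticeModels`. The tree's `Current.ursellInter_mul_sq_le`
(`ClusteringToTreeBound.lean`) is the finite-volume, current-sum form of the two displays by which
Aizenman–Duminil-Copin 2021 (Ann. of Math. **194**, arXiv:1912.07973, §4.1 "Proof of Theorem 1.3", the
same words in §6.1) derive the improved tree diagram bound: the intersection term `P` of the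
random-current identity for `U₄` satisfies
`Z[∅]² · P ≤ ∑_u clusteringMass(u) + (∑_u Z[yu]Z[xu]Z[tu]Z[zu]) / 2^r`, the clustering masses being the
un-normalised probabilities `Z[yu]Z[xu]Z[tu]Z[zu] · P^{uy,ux}⊗P^{ut,uz}[𝐌_u(𝒯; ℓ, K_s) < 7r]` that the
intersection-clustering bound (Prop. 4.3 / Prop. 6.1: "`P^{ux,uz,uy,ut}[𝐌_u < δK] ≤ 2^{-δK}`") controls.

This file performs the remaining, purely arithmetical, step of that proof ("Adding (4.3) and (4.4)
gives an improved tree diagram bound"): **granting a clustering bound of size `ε_u` at each `u`** —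
`clusteringMass(u) ≤ ε_u · Z[yu]Z[xu]Z[tu]Z[zu]` — the four-point Ursell function of the correlation
ratios `⟨σ_A⟩ = Z_K[A]/Z_K[∅]` obeys

  `|U₄(x,y,z,t)| ≤ 2 ∑_u (ε_u + 2^{-r}) ⟨σ_xσ_u⟩⟨σ_yσ_u⟩⟨σ_zσ_u⟩⟨σ_tσ_u⟩`

(`Current.ursellInter_mul_sq_le_of_clustering` in `ℝ≥0∞`, `abs_ursell_ratio_le_of_clustering` for the
real ratios `wcurrentSum K A / wcurrentSum K ∅`), for any couplings `K ≥ 0` on a finite simple graph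
whose vertex type carries a pseudo-metric, any scale sequence with `1 ≤ ℓ₁`, `2ℓ_k ≤ ℓ_{k+1}`, any
`K_s`, `r`. With `ε_u ≡ 2^{-δK}` (Prop. 6.1) and `r ≍ δK/7`, `K ≥ c log B_L` (the tree's
`BubbleScaleSequence.lean`), this is Theorem 1.3 in finite volume; the clustering bound itself, and the
passage to `ℤ⁴` and to the infinite-volume states, are not part of this file. No named fact is
introduced; everything is proved. (Compare `abs_ursell_ratio_le`, `WeightedTreeBoundCorrelations.lean`,
the same bookkeeping for the plain tree diagram bound.)

## References

* M. Aizenman, H. Duminil-Copin, Ann. of Math. 194 (2021), arXiv:1912.07973, §4.1, proof of Thm 1.3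
  ((4.3), (4.4), "Adding … gives an improved tree diagram bound"); §6.1 [AizenmanDuminilCopinAnnals2021].
-/

noncomputable section

open Finset Filter
open scoped symmDiff ENNReal

namespace Literature.Probability.LatticeModels

variable {V : Type*} [Fintype V] [DecidableEq V] {G : SimpleGraph V} [DecidableRel G.Adj]
  {K : G.edgeFinset → ℝ}

namespace Current

/-- **The intersection term under a clustering bound** (Aizenman–Duminil-Copin 2021, §4.1, "(4.3) +
(4.4)"): if `clusteringMass(u) ≤ ε_u · Z[yu]Z[xu]Z[tu]Z[zu]` for every `u`, then the intersection term
`P = ∑ 1{∂n₁=xy}1{∂n₂=zt} w w 𝟙[z ∈ C_{n₁+n₂}(x)]` of the identity for `U₄` satisfies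
`P · Z[∅]² ≤ ∑_u (ε_u + (2^r)⁻¹) Z[xu]Z[yu]Z[zu]Z[tu]`, i.e.
`|U₄| ≤ 2 ∑_u (ε_u + 2^{-r}) ⟨σ_uσ_x⟩⟨σ_uσ_y⟩⟨σ_uσ_z⟩⟨σ_uσ_t⟩` after normalisation.
[cite: AizenmanDuminilCopinAnnals2021, arXiv:1912.07973 §4.1, proof of Thm 1.3 (p. 11)] -/
theorem ursellInter_mul_sq_le_of_clustering [PseudoMetricSpace V] (hK : ∀ e, 0 ≤ K e) {ℓ : ℕ → ℕ}
    (h1 : 1 ≤ ℓ 1) (h2 : ∀ k, 2 * ℓ k ≤ ℓ (k + 1)) (Ks r : ℕ) (x y z t : V) (ε : V → ℝ≥0∞)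
    (hclus : ∀ u, clusteringMass K ℓ Ks r x y z t u ≤
      ε u * (ecurrentSum K ({y} ∆ {u}) * ecurrentSum K ({x} ∆ {u}) *
        (ecurrentSum K ({t} ∆ {u}) * ecurrentSum K ({z} ∆ {u})))) :
    (∑' p, epairWeight K ({x} ∆ {y}) ({z} ∆ {t}) p * (if z ∈ (p.1 + p.2).cluster x then 1 else 0)) *
        ecurrentSum K ∅ ^ 2 ≤
      ∑ u, (ε u + (2 ^ r)⁻¹) * (ecurrentSum K ({x} ∆ {u}) * ecurrentSum K ({y} ∆ {u}) *
        (ecurrentSum K ({z} ∆ {u}) * ecurrentSum K ({t} ∆ {u}))) := by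
  refine (ursellInter_mul_sq_le hK h1 h2 Ks r x y z t).trans ?_
  unfold treeMass
  rw [div_eq_mul_inv, Finset.sum_mul, ← Finset.sum_add_distrib]
  refine Finset.sum_le_sum fun u _ => ?_
  have hcomm : ecurrentSum K ({y} ∆ {u}) * ecurrentSum K ({x} ∆ {u}) *
      (ecurrentSum K ({t} ∆ {u}) * ecurrentSum K ({z} ∆ {u})) =
      ecurrentSum K ({x} ∆ {u}) * ecurrentSum K ({y} ∆ {u}) *
        (ecurrentSum K ({z} ∆ {u}) * ecurrentSum K ({t} ∆ {u})) := by ring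
  calc clusteringMass K ℓ Ks r x y z t u +
        ecurrentSum K ({y} ∆ {u}) * ecurrentSum K ({x} ∆ {u}) *
          (ecurrentSum K ({t} ∆ {u}) * ecurrentSum K ({z} ∆ {u})) * (2 ^ r)⁻¹
      ≤ ε u * (ecurrentSum K ({y} ∆ {u}) * ecurrentSum K ({x} ∆ {u}) *
          (ecurrentSum K ({t} ∆ {u}) * ecurrentSum K ({z} ∆ {u}))) +
        ecurrentSum K ({y} ∆ {u}) * ecurrentSum K ({x} ∆ {u}) *
          (ecurrentSum K ({t} ∆ {u}) * ecurrentSum K ({z} ∆ {u})) * (2 ^ r)⁻¹ :=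
        add_le_add (hclus u) le_rfl
    _ = (ε u + (2 ^ r)⁻¹) * (ecurrentSum K ({x} ∆ {u}) * ecurrentSum K ({y} ∆ {u}) *
          (ecurrentSum K ({z} ∆ {u}) * ecurrentSum K ({t} ∆ {u}))) := by
        rw [hcomm]; ring

end Current

/-- **The improved tree diagram bound for correlation ratios, modulo the clustering bound**
(Aizenman–Duminil-Copin 2021, §4.1/§6.1, proof of Thm 1.3, finite volume): for `K ≥ 0` on a finite graph,
`⟨σ_A⟩ := Z_K[A]/Z_K[∅]`, a doubling scale sequence, `K_s`, `r`, and reals `ε_u ≥ 0` with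
`clusteringMass(u) ≤ ε_u · Z[yu]Z[xu]Z[tu]Z[zu]` for every `u` (the content of Prop. 4.3/6.1, there with
`ε_u ≡ 2^{-δK}`):
`|⟨σ_xσ_yσ_zσ_t⟩ - ⟨σ_xσ_y⟩⟨σ_zσ_t⟩ - ⟨σ_xσ_z⟩⟨σ_yσ_t⟩ - ⟨σ_xσ_t⟩⟨σ_yσ_z⟩| ≤ 2 ∑_u (ε_u + 2^{-r}) ⟨σ_xσ_u⟩⟨σ_yσ_u⟩⟨σ_zσ_u⟩⟨σ_tσ_u⟩`.
[cite: AizenmanDuminilCopinAnnals2021, arXiv:1912.07973 §4.1, proof of Thm 1.3 ("Adding (4.3) and (4.4) gives an improved tree diagram bound", p. 11); §6.1 (p. 21)] -/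
theorem abs_ursell_ratio_le_of_clustering [PseudoMetricSpace V] (hK : ∀ e, 0 ≤ K e) {ℓ : ℕ → ℕ}
    (h1 : 1 ≤ ℓ 1) (h2 : ∀ k, 2 * ℓ k ≤ ℓ (k + 1)) (Ks r : ℕ) (x y z t : V) (ε : V → ℝ)
    (hε : ∀ u, 0 ≤ ε u)
    (hclus : ∀ u, Current.clusteringMass K ℓ Ks r x y z t u ≤
      ENNReal.ofReal (ε u) * (ecurrentSum K ({y} ∆ {u}) * ecurrentSum K ({x} ∆ {u}) *
        (ecurrentSum K ({t} ∆ {u}) * ecurrentSum K ({z} ∆ {u})))) :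
    |wcurrentSum K ({x} ∆ ({y} ∆ ({z} ∆ {t}))) / wcurrentSum K ∅ -
        wcurrentSum K ({x} ∆ {y}) / wcurrentSum K ∅ * (wcurrentSum K ({z} ∆ {t}) / wcurrentSum K ∅) -
        wcurrentSum K ({x} ∆ {z}) / wcurrentSum K ∅ * (wcurrentSum K ({y} ∆ {t}) / wcurrentSum K ∅) -
        wcurrentSum K ({x} ∆ {t}) / wcurrentSum K ∅ * (wcurrentSum K ({y} ∆ {z}) / wcurrentSum K ∅)| ≤
      2 * ∑ u, (ε u + ((2 : ℝ) ^ r)⁻¹) * (wcurrentSum K ({x} ∆ {u}) / wcurrentSum K ∅ *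
        (wcurrentSum K ({y} ∆ {u}) / wcurrentSum K ∅) *
        (wcurrentSum K ({z} ∆ {u}) / wcurrentSum K ∅) * (wcurrentSum K ({t} ∆ {u}) / wcurrentSum K ∅)) := by
  set W : Finset V → ℝ := fun A => wcurrentSum K A with hW
  have hW' : ∀ A, (ecurrentSum K A).toReal = W A := fun A => toReal_ecurrentSum hK A
  have hW0 : 0 < W ∅ := wcurrentSum_empty_pos hK
  have hWnn : ∀ A, 0 ≤ W A := fun A => wcurrentSum_nonneg hK A
  have hZtop : ∀ A, ecurrentSum K A ≠ ∞ := fun A => ecurrentSum_ne_top hK A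
  -- the intersection term `P` and its finiteness
  set Pe : ℝ≥0∞ := ∑' p : Current G × Current G,
    epairWeight K ({x} ∆ {y}) ({z} ∆ {t}) p * (if z ∈ (p.1 + p.2).cluster x then 1 else 0) with hPe
  have hPle : Pe ≤ ecurrentSum K ({x} ∆ {y}) * ecurrentSum K ({z} ∆ {t}) := by
    rw [← tsum_epairWeight]
    refine ENNReal.tsum_le_tsum fun p => ?_
    calc epairWeight K ({x} ∆ {y}) ({z} ∆ {t}) p * (if z ∈ (p.1 + p.2).cluster x then 1 else 0)
        ≤ epairWeight K ({x} ∆ {y}) ({z} ∆ {t}) p * 1 := mul_le_mul' le_rfl (by split_ifs <;> simp)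
      _ = _ := mul_one _
  have hPtop : Pe ≠ ∞ := ne_top_of_le_ne_top (ENNReal.mul_ne_top (hZtop _) (hZtop _)) hPle
  set p : ℝ := Pe.toReal with hp
  have hp0 : 0 ≤ p := ENNReal.toReal_nonneg
  -- the identity in `ℝ`
  have hid := congrArg ENNReal.toReal (Current.ursellFour_currentSum_identity hK x y z t)
  rw [ENNReal.toReal_add (ENNReal.add_ne_top.2 ⟨ENNReal.mul_ne_top (hZtop _) (hZtop _),
      ENNReal.mul_ne_top (hZtop _) (hZtop _)⟩) (ENNReal.mul_ne_top (hZtop _) (hZtop _)),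
    ENNReal.toReal_add (ENNReal.mul_ne_top (hZtop _) (hZtop _)) (ENNReal.mul_ne_top (hZtop _) (hZtop _)),
    ENNReal.toReal_add (ENNReal.mul_ne_top (hZtop _) (hZtop _)) (ENNReal.mul_ne_top (by simp) hPtop)] at hid
  simp only [ENNReal.toReal_mul, ENNReal.toReal_ofNat, hW'] at hid
  -- the coefficients `ε_u + 2^{-r}` in `ℝ≥0∞` and in `ℝ`
  have hcoef_top : ∀ u, ENNReal.ofReal (ε u) + ((2 : ℝ≥0∞) ^ r)⁻¹ ≠ ∞ := fun u =>
    ENNReal.add_ne_top.2 ⟨ENNReal.ofReal_ne_top, ENNReal.inv_ne_top.2 (pow_ne_zero _ two_ne_zero)⟩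
  have hcoef : ∀ u, (ENNReal.ofReal (ε u) + ((2 : ℝ≥0∞) ^ r)⁻¹).toReal = ε u + ((2 : ℝ) ^ r)⁻¹ := by
    intro u
    rw [ENNReal.toReal_add ENNReal.ofReal_ne_top (ENNReal.inv_ne_top.2 (pow_ne_zero _ two_ne_zero)),
      ENNReal.toReal_ofReal (hε u), ENNReal.toReal_inv, ENNReal.toReal_pow, ENNReal.toReal_ofNat]
  -- the bound in `ℝ`
  have hterm_top : ∀ u, (ENNReal.ofReal (ε u) + ((2 : ℝ≥0∞) ^ r)⁻¹) *
      (ecurrentSum K ({x} ∆ {u}) * ecurrentSum K ({y} ∆ {u}) *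
        (ecurrentSum K ({z} ∆ {u}) * ecurrentSum K ({t} ∆ {u}))) ≠ ∞ := fun u =>
    ENNReal.mul_ne_top (hcoef_top u)
      (ENNReal.mul_ne_top (ENNReal.mul_ne_top (hZtop _) (hZtop _)) (ENNReal.mul_ne_top (hZtop _) (hZtop _)))
  have hbd := ENNReal.toReal_mono (ENNReal.sum_ne_top.2 fun u _ => hterm_top u)
    (Current.ursellInter_mul_sq_le_of_clustering hK h1 h2 Ks r x y z t (fun u => ENNReal.ofReal (ε u)) hclus)
  rw [ENNReal.toReal_mul, ENNReal.toReal_pow, ENNReal.toReal_sum (fun u _ => hterm_top u)] at hbd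
  simp only [ENNReal.toReal_mul, hW', hcoef] at hbd
  -- `hid : Wxy Wzt + Wxz Wyt + Wxt Wyz = WD W∅ + 2 p`, `hbd : p W∅² ≤ ∑ (ε u + 2^{-r}) Wxu Wyu (Wzu Wtu)`
  change |W _ / W ∅ - W _ / W ∅ * (W _ / W ∅) - W _ / W ∅ * (W _ / W ∅) - W _ / W ∅ * (W _ / W ∅)| ≤
    2 * ∑ u, (ε u + ((2 : ℝ) ^ r)⁻¹) * (W _ / W ∅ * (W _ / W ∅) * (W _ / W ∅) * (W _ / W ∅))
  have hL : W ({x} ∆ ({y} ∆ ({z} ∆ {t}))) / W ∅ - W ({x} ∆ {y}) / W ∅ * (W ({z} ∆ {t}) / W ∅) -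
      W ({x} ∆ {z}) / W ∅ * (W ({y} ∆ {t}) / W ∅) - W ({x} ∆ {t}) / W ∅ * (W ({y} ∆ {z}) / W ∅) =
      -(2 * (p * W ∅ ^ 2) / W ∅ ^ 4) := by
    field_simp
    rw [← hp] at hid
    nlinarith [hid]
  have hR : ∑ u, (ε u + ((2 : ℝ) ^ r)⁻¹) *
      (W ({x} ∆ {u}) / W ∅ * (W ({y} ∆ {u}) / W ∅) * (W ({z} ∆ {u}) / W ∅) * (W ({t} ∆ {u}) / W ∅)) =
      (∑ u, (ε u + ((2 : ℝ) ^ r)⁻¹) * (W ({x} ∆ {u}) * W ({y} ∆ {u}) * (W ({z} ∆ {u}) * W ({t} ∆ {u})))) /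
        W ∅ ^ 4 := by
    rw [Finset.sum_div]
    refine Finset.sum_congr rfl fun u _ => ?_
    field_simp
  rw [hL, hR, abs_neg, abs_of_nonneg (by positivity), mul_div_assoc]
  refine mul_le_mul_of_nonneg_left (div_le_div_of_nonneg_right ?_ (by positivity)) (by norm_num)
  rw [← hp] at hbd
  exact hbd

end Literature.Probability.LatticeModels
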